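import Mathlib
import HarnessLib
import Summits.HubbardSuperconductivity.HubbardSuperconductivity.Theorems.KLProgrammeKLRegimeTwoVolumeFrameDefect
import Summits.HubbardSuperconductivity.HubbardSuperconductivity.Theorems.KLProgrammeKLRegimeSplitEvalDerivBounds
import Summits.HubbardSuperconductivity.HubbardSuperconductivity.Theorems.KLProgrammeKLRegimeEngineFrameShiftSymbolMomentsFrames

/-!
# Route `KLProgramme` — VL child `KLRegimeVolumeLimitV17F2` (stmt-HubbardSuperconductivity-20440), closer MODEL file M2 «MISMATCH-SLICE», part 4:
# the band-increment data `P₀ … P₃` of TWO FRAMES from their coefficient weights, and of the two volumes' flow frames from the tower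
# (`P_j = c_j(n)/L`) — the inputs `hv₀ … hv₃` of `TorusFourierL2.sliceDefectPairWt_bgmFat_le` / `rowSumWt_sliceCT_sub_bgmFat_le`

Cell `gate-hubbard-kl`, seat hubbard-kl-k3c4-p2 (g11; UV / Matsubara all-U lane), ask «MISMATCH-SLICE» (= M2) of the VL registrant k3c4-p1 g11
(KL STATUS 2026-08-27 21:51Z; pen (R75)).  The slice twin of `…TwoVolumeFrameDefect` §3: the DEFECT rows of parts 1–3
(`…SectorSliceDefectRows`, `…SectorSliceDefectPairFat`, `…SectorSliceDefectRowsFat`) read the second frame `K′` only through the Euclidean sup norms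
of `e_{K′} − e_K = evalM (K ⊖ K′)` and its first three derivatives.  Here:

* §1 `frameLevel_sub_eq_evalM_fsub` (`e_{K′} − e_K = evalM (K ⊖ K′)` as functions on `Momentum`), `coeffNorm_fsub_comm`,
  **`incrementData_of_coeffNorm`** — `coeffNorm j (K ⊖ K′) ≤ ε_j` (`j ≤ 3`) ⟹ `|e_{K′} − e_K| ≤ ε₀`, `‖D(e_{K′} − e_K)‖ ≤ ε₁`, `‖D²(…)‖ ≤ ε₂`,
  `‖D³(…)‖ ≤ ε₃` (the `hv₀ … hv₃` shapes of k3c3-p2's increment lemma), and the version from `coeffNorm j (K′ ⊖ K)`;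
* §2 **`incrementData_twoVolume_of_towerV17F2`** — under `TowerP klPredsV17F2 …` (`μ ∈ klWindowC`), for `Lstar ≤ L ≤ L′` with the thresholds of
  `…FlowFramesJets` and `n ≤ nScales β + 1`: with the base frame the FINE volume's flow frame `K = K_n^{(L′,M′)}` (where the fat family of the
  own-top-frame organisation lives) and `K′ = K_n^{(L,M)}`, the data are `P_j = c_j(n)/L`, `c_j(n) = Σ_{m<n} 4(2d_m+1)(1+4d_m)^j·Q.CL β m`
  (`coeffNorm_fsub_klFlowFrameU_le_of_towerV17F2`), `j = 0, …, 3`; and the swapped orientation.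

Everything is proved; no definitions, no named facts; nothing about the model is asserted. [folklore]
-/

noncomputable section

namespace Summit.HubbardSuperconductivity.HubbardSuperconductivity.Theorems.TwoPointAssembly

set_option linter.dupNamespace false -- summit = problem name (single-conjunct summit), D-0017

open Real Finset Filter Topology Literature.MathematicalPhysics.QuantumLattice Literature.Probability.LatticeModels
open Summit.HubbardSuperconductivity.HubbardSuperconductivity.Theorems.DispersionFlow
open Summit.HubbardSuperconductivity.HubbardSuperconductivity.Theorems.KLRegimeSplit
open Summit.HubbardSuperconductivity.HubbardSuperconductivity.Theorems.KLProgrammeLegKernels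
open Summit.HubbardSuperconductivity.HubbardSuperconductivity.Theorems.EngineV8 (frameLevel_eq_zero_sub_evalM)

/-! ## §1 The band increment of two frames from the coefficient weights of their difference -/

/-- **`e_{K′} − e_K = evalM (K ⊖ K′)`** as functions on `Momentum` (`e_K = e_0 − evalM K`). [folklore] -/
theorem frameLevel_sub_eq_evalM_fsub (μ : ℝ) (K K' : TrigPolyC4v) :
    (fun p : Momentum => frameLevel μ K' p - frameLevel μ K p) = evalM (fsub K K') := by
  funext p
  rw [frameLevel_eq_zero_sub_evalM μ K', frameLevel_eq_zero_sub_evalM μ K, evalM_fsub]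
  ring

/-- **`coeffNorm` of a frame difference is symmetric**: `coeffNorm r (A ⊖ B) = coeffNorm r (B ⊖ A)`. [folklore] -/
theorem coeffNorm_fsub_comm (A B : TrigPolyC4v) (r : ℕ) : (fsub A B).coeffNorm r = (fsub B A).coeffNorm r := by
  have hAB : (fsub A B).degree ≤ max A.degree B.degree := le_of_eq rfl
  have hBA : (fsub B A).degree ≤ max A.degree B.degree := le_of_eq (max_comm _ _)
  rw [coeffNorm_eq_sum_coeffExt _ hAB r, coeffNorm_eq_sum_coeffExt _ hBA r]
  refine sum_congr rfl fun m _ => sum_congr rfl fun n _ => ?_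
  rw [coeffExt_fsub, coeffExt_fsub, abs_sub_comm]

/-- **THE BAND-INCREMENT DATA FROM COEFFICIENT WEIGHTS**: if `coeffNorm j (K ⊖ K′) ≤ ε_j` for `j = 0, 1, 2, 3` then
`|e_{K′} − e_K| ≤ ε₀`, `‖D(e_{K′} − e_K)‖ ≤ ε₁`, `‖D²(e_{K′} − e_K)‖ ≤ ε₂`, `‖D³(e_{K′} − e_K)‖ ≤ ε₃` at every `p` — the hypotheses `hv₀ … hv₃` of
`TorusFourierL2.sliceIncrPairWt_charSum_l1_le` / `sliceDefectPairWt_bgmFat_le` (`norm_iteratedFDeriv_evalM_le_coeffNorm`). [folklore] -/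
theorem incrementData_of_coeffNorm (μ : ℝ) (K K' : TrigPolyC4v) {ε₀ ε₁ ε₂ ε₃ : ℝ} (h0 : (fsub K K').coeffNorm 0 ≤ ε₀)
    (h1 : (fsub K K').coeffNorm 1 ≤ ε₁) (h2 : (fsub K K').coeffNorm 2 ≤ ε₂) (h3 : (fsub K K').coeffNorm 3 ≤ ε₃) :
    (∀ p : Momentum, |frameLevel μ K' p - frameLevel μ K p| ≤ ε₀) ∧
    (∀ p : Momentum, ‖fderiv ℝ (fun p : Momentum => frameLevel μ K' p - frameLevel μ K p) p‖ ≤ ε₁) ∧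
    (∀ p : Momentum, ‖iteratedFDeriv ℝ 2 (fun p : Momentum => frameLevel μ K' p - frameLevel μ K p) p‖ ≤ ε₂) ∧
    (∀ p : Momentum, ‖iteratedFDeriv ℝ 3 (fun p : Momentum => frameLevel μ K' p - frameLevel μ K p) p‖ ≤ ε₃) := by
  have hF := frameLevel_sub_eq_evalM_fsub μ K K'
  refine ⟨fun p => ?_, fun p => ?_, fun p => ?_, fun p => ?_⟩
  · have h := norm_iteratedFDeriv_evalM_le_coeffNorm (fsub K K') 0 p
    rw [norm_iteratedFDeriv_zero, Real.norm_eq_abs] at h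
    have e := congrFun hF p
    rw [e]; exact h.trans h0
  · have h := norm_iteratedFDeriv_evalM_le_coeffNorm (fsub K K') 1 p
    rw [norm_iteratedFDeriv_one] at h
    rw [hF]; exact h.trans h1
  · rw [hF]; exact (norm_iteratedFDeriv_evalM_le_coeffNorm (fsub K K') 2 p).trans h2
  · rw [hF]; exact (norm_iteratedFDeriv_evalM_le_coeffNorm (fsub K K') 3 p).trans h3

/-- The same data from the coefficient weights of the SWAPPED difference `K′ ⊖ K` (`coeffNorm_fsub_comm`). [folklore] -/
theorem incrementData_of_coeffNorm' (μ : ℝ) (K K' : TrigPolyC4v) {ε₀ ε₁ ε₂ ε₃ : ℝ} (h0 : (fsub K' K).coeffNorm 0 ≤ ε₀)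
    (h1 : (fsub K' K).coeffNorm 1 ≤ ε₁) (h2 : (fsub K' K).coeffNorm 2 ≤ ε₂) (h3 : (fsub K' K).coeffNorm 3 ≤ ε₃) :
    (∀ p : Momentum, |frameLevel μ K' p - frameLevel μ K p| ≤ ε₀) ∧
    (∀ p : Momentum, ‖fderiv ℝ (fun p : Momentum => frameLevel μ K' p - frameLevel μ K p) p‖ ≤ ε₁) ∧
    (∀ p : Momentum, ‖iteratedFDeriv ℝ 2 (fun p : Momentum => frameLevel μ K' p - frameLevel μ K p) p‖ ≤ ε₂) ∧
    (∀ p : Momentum, ‖iteratedFDeriv ℝ 3 (fun p : Momentum => frameLevel μ K' p - frameLevel μ K p) p‖ ≤ ε₃) :=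
  incrementData_of_coeffNorm μ K K' (by rw [coeffNorm_fsub_comm]; exact h0) (by rw [coeffNorm_fsub_comm]; exact h1)
    (by rw [coeffNorm_fsub_comm]; exact h2) (by rw [coeffNorm_fsub_comm]; exact h3)

/-! ## §2 The two volumes' flow frames under the tower: `P_j = c_j(n)/L` -/

section Tower

variable {G : GeoConsts} {P : SplitConsts} {Q : EngConsts} {R : RenConsts} {β U μ : ℝ} {K₀ : TrigPolyC4v} {Lstar : ℕ} {Mstar : ℕ → ℕ}

/-- **THE BAND-INCREMENT DATA OF THE TWO VOLUMES' FLOW FRAMES, FROM THE TOWER** — base frame the FINE volume's `K = K_n^{(L′,M′)}`, second frame the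
COARSE volume's `K′ = K_n^{(L,M)}` (`Lstar ≤ L ≤ L′`, thresholds as in `…FlowFramesJets`, `n ≤ nScales β + 1`): `P_j = c_j(n)/L`,
`c_j(n) = Σ_{m<n} 4(2d_m+1)(1+4d_m)^j·Q.CL β m`, `j = 0, 1, 2, 3`. -/
theorem incrementData_twoVolume_of_towerV17F2 (hμ : μ ∈ klWindowC) (hT : TowerP klPredsV17F2 G P Q R β U μ K₀ Lstar Mstar)
    {L : ℕ} [NeZero L] (hL : Lstar ≤ L) {L' : ℕ} [NeZero L'] (hLL' : L ≤ L')
    {M : ℕ} [NeZero M] (hM₁ : Mstar L ≤ M) (hM₂ : Q.M0 β L ≤ M) {M' : ℕ} [NeZero M'] (hM'₁ : Mstar L' ≤ M') (hM'₂ : Q.M0 β L' ≤ M')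
    {n : ℕ} (hn : n ≤ nScales β + 1) :
    (∀ p : Momentum, |frameLevel μ (klFlowFrameU L M β U μ n) p - frameLevel μ (klFlowFrameU L' M' β U μ n) p| ≤
        (∑ m ∈ range n, 4 * (2 * klFlowDeg m + 1) * (1 + 4 * klFlowDeg m) ^ 0 * Q.CL β m) / L) ∧
    (∀ p : Momentum, ‖fderiv ℝ (fun p : Momentum => frameLevel μ (klFlowFrameU L M β U μ n) p - frameLevel μ (klFlowFrameU L' M' β U μ n) p) p‖ ≤
        (∑ m ∈ range n, 4 * (2 * klFlowDeg m + 1) * (1 + 4 * klFlowDeg m) ^ 1 * Q.CL β m) / L) ∧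
    (∀ p : Momentum, ‖iteratedFDeriv ℝ 2
        (fun p : Momentum => frameLevel μ (klFlowFrameU L M β U μ n) p - frameLevel μ (klFlowFrameU L' M' β U μ n) p) p‖ ≤
        (∑ m ∈ range n, 4 * (2 * klFlowDeg m + 1) * (1 + 4 * klFlowDeg m) ^ 2 * Q.CL β m) / L) ∧
    (∀ p : Momentum, ‖iteratedFDeriv ℝ 3
        (fun p : Momentum => frameLevel μ (klFlowFrameU L M β U μ n) p - frameLevel μ (klFlowFrameU L' M' β U μ n) p) p‖ ≤
        (∑ m ∈ range n, 4 * (2 * klFlowDeg m + 1) * (1 + 4 * klFlowDeg m) ^ 3 * Q.CL β m) / L) :=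
  incrementData_of_coeffNorm' μ (klFlowFrameU L' M' β U μ n) (klFlowFrameU L M β U μ n)
    (coeffNorm_fsub_klFlowFrameU_le_of_towerV17F2 hμ hT hL hLL' hM₁ hM₂ hM'₁ hM'₂ hn 0)
    (coeffNorm_fsub_klFlowFrameU_le_of_towerV17F2 hμ hT hL hLL' hM₁ hM₂ hM'₁ hM'₂ hn 1)
    (coeffNorm_fsub_klFlowFrameU_le_of_towerV17F2 hμ hT hL hLL' hM₁ hM₂ hM'₁ hM'₂ hn 2)
    (coeffNorm_fsub_klFlowFrameU_le_of_towerV17F2 hμ hT hL hLL' hM₁ hM₂ hM'₁ hM'₂ hn 3)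

/-- **The swapped orientation** (base frame the COARSE volume's `K_n^{(L,M)}`, second frame the fine `K_n^{(L′,M′)}`): the same `P_j = c_j(n)/L`. -/
theorem incrementData_twoVolume_of_towerV17F2' (hμ : μ ∈ klWindowC) (hT : TowerP klPredsV17F2 G P Q R β U μ K₀ Lstar Mstar)
    {L : ℕ} [NeZero L] (hL : Lstar ≤ L) {L' : ℕ} [NeZero L'] (hLL' : L ≤ L')
    {M : ℕ} [NeZero M] (hM₁ : Mstar L ≤ M) (hM₂ : Q.M0 β L ≤ M) {M' : ℕ} [NeZero M'] (hM'₁ : Mstar L' ≤ M') (hM'₂ : Q.M0 β L' ≤ M')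
    {n : ℕ} (hn : n ≤ nScales β + 1) :
    (∀ p : Momentum, |frameLevel μ (klFlowFrameU L' M' β U μ n) p - frameLevel μ (klFlowFrameU L M β U μ n) p| ≤
        (∑ m ∈ range n, 4 * (2 * klFlowDeg m + 1) * (1 + 4 * klFlowDeg m) ^ 0 * Q.CL β m) / L) ∧
    (∀ p : Momentum, ‖fderiv ℝ (fun p : Momentum => frameLevel μ (klFlowFrameU L' M' β U μ n) p - frameLevel μ (klFlowFrameU L M β U μ n) p) p‖ ≤
        (∑ m ∈ range n, 4 * (2 * klFlowDeg m + 1) * (1 + 4 * klFlowDeg m) ^ 1 * Q.CL β m) / L) ∧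
    (∀ p : Momentum, ‖iteratedFDeriv ℝ 2
        (fun p : Momentum => frameLevel μ (klFlowFrameU L' M' β U μ n) p - frameLevel μ (klFlowFrameU L M β U μ n) p) p‖ ≤
        (∑ m ∈ range n, 4 * (2 * klFlowDeg m + 1) * (1 + 4 * klFlowDeg m) ^ 2 * Q.CL β m) / L) ∧
    (∀ p : Momentum, ‖iteratedFDeriv ℝ 3
        (fun p : Momentum => frameLevel μ (klFlowFrameU L' M' β U μ n) p - frameLevel μ (klFlowFrameU L M β U μ n) p) p‖ ≤
        (∑ m ∈ range n, 4 * (2 * klFlowDeg m + 1) * (1 + 4 * klFlowDeg m) ^ 3 * Q.CL β m) / L) :=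
  incrementData_of_coeffNorm μ (klFlowFrameU L M β U μ n) (klFlowFrameU L' M' β U μ n)
    (coeffNorm_fsub_klFlowFrameU_le_of_towerV17F2 hμ hT hL hLL' hM₁ hM₂ hM'₁ hM'₂ hn 0)
    (coeffNorm_fsub_klFlowFrameU_le_of_towerV17F2 hμ hT hL hLL' hM₁ hM₂ hM'₁ hM'₂ hn 1)
    (coeffNorm_fsub_klFlowFrameU_le_of_towerV17F2 hμ hT hL hLL' hM₁ hM₂ hM'₁ hM'₂ hn 2)
    (coeffNorm_fsub_klFlowFrameU_le_of_towerV17F2 hμ hT hL hLL' hM₁ hM₂ hM'₁ hM'₂ hn 3)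

end Tower

end Summit.HubbardSuperconductivity.HubbardSuperconductivity.Theorems.TwoPointAssembly

end
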